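import Summits.BirchSwinnertonDyer.BirchSwinnertonDyer.Theorems.GenusKolyvaginAtTwoEquivariantKolyvaginExactAtTwoArchimedeanVanishing
import Summits.BirchSwinnertonDyer.BirchSwinnertonDyer.Theorems.CMKolyvaginAtInertTwoConjugationTypeAtTwo
import Literature.NumberTheory.GaloisRepresentations.AbsGaloisInvolutions
import Literature.NumberTheory.GaloisRepresentations.ArchimedeanLocalDuality
import Literature.NumberTheory.EllipticCurves.GeomPointsGaloisModule
import HarnessLib

/-!
# Route `GenusKolyvaginAtTwo`, LINE 6, KEY crux Q3 `EquivariantKolyvaginExactAtTwo`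
# (stmt-BirchSwinnertonDyer-24882): `Δ(E) < 0` ⟹ `H¹(ℚ_∞, E) = 0` — the real place imposes NO
# condition at `2` on the habitat (PROVED; sequel to `…ArchimedeanVanishing`)

Helper (seat `bsd-line-gk2-p3` g10, cell `bsd-f1-sign2`; `--supports` the item, closes nothing).
`…ArchimedeanVanishing` (this seat, p616046) proved `H¹(K_w, E) = 0` at an infinite place whose
decomposition group MOVES a `2`-torsion point of `E(K̄_w)`. This file discharges that hypothesis on the
habitat of Q3 — `E/ℚ` with `Δ(E) < 0` — from tree theorems:

* §5 `absGaloisRestrict_ne_one_infinitePlace` — a non-trivial `σ ∈ Γ_{K_w}` restricts NON-TRIVIALLY to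
  `Γ_K` (it inverts `i`, `i⁴ = 1`: `absGaloisRestrict_smul_eq_inv_of_pow_eq_one_infinitePlace`);
  `absGaloisRestrict_sq_eq_one_infinitePlace` (`#Γ_{K_w} ≤ 2`); hence over `ℚ`
  `isComplexConjugation_absGaloisRestrict_rat` — **the restriction is a complex conjugation** for the
  unique `ℚ →+* ℝ` (the tree's Artin–Schreier theorem `exists_isComplexConjugation_of_sq_eq_one`).
* §6 `exists_twoTorsion_localPoints_smul_ne_of_Δ_neg` — **`Δ(E) < 0` ⟹ every `σ ≠ 1` in `Γ_{ℚ_∞}`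
  moves a point of `E(ℚ̄_∞)[2]`**: the complex conjugation `res σ` moves some `v ∈ E(ℚ̄)[2]` (the
  sibling route's `KolyvaginEigenTwo.exists_twoTorsion_smul_ne_of_Δ_neg`: one real root of the
  `2`-division cubic), and `pointsMap : E(ℚ̄) → E(ℚ̄_∞)` is injective and equivariant
  (`pointsMap_smul`).
* §7 on the habitat: `localH1_infinitePlace_eq_zero_of_Δ_neg` (**`H¹(ℚ_∞, E(ℚ̄_∞)) = 0`**, also when
  `Γ_{ℚ_∞}` is trivial), `localRestrictionKer_infinitePlace_eq_top_of_Δ_neg`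
  (**`H¹(ℚ, E) → H¹(ℚ_∞, E)` is zero**), `selmerLocalKerPrimary_infinitePlace_eq_top_of_Δ_neg`
  (**the `p^∞`-Selmer condition at `∞` is vacuous, every `p`**) and
  `selmerLocalKerPrimary_infinitePlace_quadraticTwist_eq_top_of_Δ_neg` (the same for every twist
  `E^{(d)}`, `Δ(E^{(d)}) = d⁶Δ(E) < 0`; in particular the twin `E^K`).

Reading for Q3 (memo Q3-ARCH v2; g9's `…Descent` §5 "no archimedean condition at `2` on `Δ < 0`",
now a theorem): when McCallum §5 is run OVER `ℚ` at `p = 2` for `E` and `E^K`, the real place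
contributes neither a Selmer condition nor a Poitou–Tate term. Classically this is
`H¹(ℝ, E) ≅ π₀(E(ℝ))^∨` with `E(ℝ)` connected for `Δ < 0` [MilneADT2006, I Rem. 3.7]; here it is
obtained without Lie theory. Everything is PROVED from tree theorems (no named fact, no definition,
no `sorry`, standard axioms). BSD is not proved by any of this.

References: [MilneADT2006] I Thm. 2.13, Rem. 3.7; [SerreGaloisCohomology1997] I §2.4;
[ArtinSchreier1927Kennzeichnung] Satz 4; [SilvermanAEC2009] III.1, Cor. III.6.4(b), X.§2;
[GrossLMS1991] §6, proof of Prop. 6.2 (1).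
-/

set_option autoImplicit false
set_option linter.dupNamespace false -- tree convention: `Summit.BirchSwinnertonDyer.BirchSwinnertonDyer.Theorems` (summit = sub-problem)

noncomputable section

open scoped Classical

namespace Summit.BirchSwinnertonDyer.BirchSwinnertonDyer.Theorems.GenusExact.ArchVanishing

open WeierstrassCurve NumberField Field
open Literature.NumberTheory.EllipticCurves Literature.NumberTheory.GaloisRepresentations

/-! ## §5 A non-trivial element of `Γ_{K_w}` restricts to a complex conjugation of `Γ_K` -/

section Restrict

variable {K : Type} [Field K] [NumberField K] (w : InfinitePlace K)

/-- **A non-trivial element of `Γ_{K_w}` (`w` infinite) restricts NON-TRIVIALLY to `Γ_K`**: it inverts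
the `4`-th roots of unity of `K̄` (`absGaloisRestrict_smul_eq_inv_of_pow_eq_one_infinitePlace`), and
`i⁻¹ = −i ≠ i`. [cite: MilneADT2006, Ch. I, Thm. 2.13] -/
theorem absGaloisRestrict_ne_one_infinitePlace {σ : absoluteGaloisGroup w.Completion} (hσ : σ ≠ 1) :
    absGaloisRestrict K w.Completion σ ≠ 1 := by
  -- a square root of `-1` in `K̄`
  obtain ⟨i, hi⟩ := IsAlgClosed.exists_pow_nat_eq (-1 : AlgebraicClosure K) two_pos
  have hi4 : i ^ 4 = 1 := by
    rw [show (4 : ℕ) = 2 * 2 from rfl, pow_mul, hi]; norm_num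
  have hi0 : i ≠ 0 := fun h ↦ by
    rw [h, zero_pow two_ne_zero] at hi
    exact one_ne_zero (neg_eq_zero.mp hi.symm)
  intro h1
  have h := absGaloisRestrict_smul_eq_inv_of_pow_eq_one_infinitePlace w hσ (by norm_num : (4 : ℕ) ≠ 0) hi4
  rw [h1, one_smul] at h
  -- `i = i⁻¹` forces `i² = 1`, contradicting `i² = -1`
  have hsq : i ^ 2 = 1 := by
    rw [pow_two]
    nth_rewrite 2 [h]
    rw [mul_inv_cancel₀ hi0]
  rw [hsq] at hi
  have h2 : (2 : AlgebraicClosure K) = 0 := by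
    have := congrArg (fun x : AlgebraicClosure K ↦ x + 1) hi
    simp only [neg_add_cancel] at this
    rw [← this]; norm_num
  exact two_ne_zero h2

/-- `K_w` has characteristic `0` (stated for a general number field `K`, so that at `K = ℚ` no
`ℚ`-algebra instance diamond arises). [folklore] -/
theorem charZero_completion_infinitePlace : CharZero w.Completion :=
  charZero_of_injective_algebraMap (algebraMap K w.Completion).injective

omit [NumberField K] in
/-- Its square is `1` (`#Γ_{K_w} ≤ 2`). [cite: SerreGaloisCohomology1997, I §2.4] -/
theorem absGaloisRestrict_sq_eq_one_infinitePlace (σ : absoluteGaloisGroup w.Completion) :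
    absGaloisRestrict K w.Completion σ ^ 2 = 1 := by
  haveI := finite_absoluteGaloisGroup_completion_infinitePlace w
  rw [pow_two, ← map_mul, mul_self_eq_one_of_natCard_le_two
    (natCard_absoluteGaloisGroup_completion_infinitePlace_le_two w) σ, map_one]

/-- **Over `ℚ`: a non-trivial element of `Γ_{ℚ_∞}` restricts to a complex conjugation of `Γ_ℚ`** for
the (unique) embedding `ℚ → ℝ` (every involution `≠ 1` of `Γ_ℚ` is a complex conjugation for some real
embedding — the tree's Artin–Schreier theorem `exists_isComplexConjugation_of_sq_eq_one` — and
`ℚ →+* ℝ` is unique). [cite: ArtinSchreier1927Kennzeichnung, Satz 4] -/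
theorem isComplexConjugation_absGaloisRestrict_rat (w : InfinitePlace ℚ)
    {σ : absoluteGaloisGroup w.Completion} (hσ : σ ≠ 1) :
    IsComplexConjugation (Rat.castHom ℝ) (absGaloisRestrict ℚ w.Completion σ) := by
  obtain ⟨φ, hφ⟩ := exists_isComplexConjugation_of_sq_eq_one (absGaloisRestrict ℚ w.Completion σ)
    (absGaloisRestrict_ne_one_infinitePlace w hσ) (absGaloisRestrict_sq_eq_one_infinitePlace w σ)
  rwa [Subsingleton.elim φ (Rat.castHom ℝ)] at hφ

end Restrict

/-! ## §6 `Δ(E) < 0`: every non-trivial element of `Γ_{ℚ_∞}` moves a `2`-torsion point of `E(ℚ̄_∞)` -/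

section NegDisc

variable (W : WeierstrassCurve ℚ) [W.IsElliptic] (w : InfinitePlace ℚ)

/-- **`Δ(E) < 0` ⟹ the decomposition group at `∞` moves a `2`-torsion point.** For `W/ℚ` elliptic with
`Δ < 0` and `σ ≠ 1` in `Γ_{ℚ_∞}`: `σ` restricts to a complex conjugation `c₀ ∈ Γ_ℚ` (§5), which moves
some `v ∈ E(ℚ̄)[2]` (the tree's `KolyvaginEigenTwo.exists_twoTorsion_smul_ne_of_Δ_neg`: with `Δ < 0`
the `2`-division cubic has ONE real root), and the points map `E(ℚ̄) → E(ℚ̄_∞)` along the chosen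
embedding is injective and equivariant (`pointsMap_smul`), so `σ` moves the image of `v`.
[cite: SilvermanAEC2009, III.1 (the 2-division cubic) and Cor. III.6.4(b)] -/
theorem exists_twoTorsion_localPoints_smul_ne_of_Δ_neg (hΔ : W.Δ < 0)
    {σ : absoluteGaloisGroup w.Completion} (hσ : σ ≠ 1) :
    ∃ T : localPoints W w.Completion, 2 • T = 0 ∧ σ • T ≠ T := by
  have hc₀ := isComplexConjugation_absGaloisRestrict_rat w hσ
  obtain ⟨v, hv⟩ := KolyvaginEigenTwo.exists_twoTorsion_smul_ne_of_Δ_neg W hΔ hc₀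
  refine ⟨pointsMap W w.Completion (v : geomPoints W), ?_, ?_⟩
  · have hv2 : (2 : ℤ) • (v : geomPoints W) = 0 := (mem_geomTorsion_iff W 2 _).mp v.2
    rw [← natCast_zsmul, Nat.cast_ofNat, ← map_zsmul, hv2, map_zero]
  · intro h
    apply hv
    apply Subtype.ext
    apply pointsMapOfEmb_injective W (closureEmb (K := ℚ) w.Completion)
    change pointsMap W w.Completion ((absGaloisRestrict ℚ w.Completion σ • v : geomTorsion W 2) :
        geomPoints W) = pointsMap W w.Completion (v : geomPoints W)
    rw [Literature.NumberTheory.EllipticCurves.AddSubgroup.torsionBy.coe_smul, ← resGal_eq_absGaloisRestrict,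
      pointsMap_smul]
    exact h

end NegDisc

/-! ## §7 The habitat of Q3: `Δ(E) < 0` ⟹ `H¹(ℚ_∞, E) = 0`, no archimedean Selmer condition,
for `E` and for every quadratic twist -/

section Habitat

variable (W : WeierstrassCurve ℚ) [W.IsElliptic] (w : InfinitePlace ℚ)

/-- **`Δ(E) < 0` ⟹ `H¹(ℚ_∞, E(ℚ̄_∞)) = 0`** (every class of `localH1` vanishes): if `Γ_{ℚ_∞}` has a
non-trivial element it moves a `2`-torsion point (§6) and `localH1_eq_zero` applies; if not, `H¹` of
the trivial group vanishes. Classically: `H¹(ℝ, E) ≅ π₀(E(ℝ))^∨ = 0` since `E(ℝ)` is connected for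
`Δ < 0` — here WITHOUT Lie theory. [cite: MilneADT2006, I Rem. 3.7] [cite: GrossLMS1991, §6 (proof of Prop. 6.2 (1))] -/
theorem localH1_infinitePlace_eq_zero_of_Δ_neg (hΔ : W.Δ < 0) (x : W.localH1 w.Completion) : x = 0 := by
  by_cases h : ∃ σ : absoluteGaloisGroup w.Completion, σ ≠ 1
  · obtain ⟨σ, hσ⟩ := h
    haveI := finite_absoluteGaloisGroup_completion_infinitePlace w
    haveI := charZero_completion_infinitePlace (K := ℚ) w
    obtain ⟨T, hT2, hσT⟩ := exists_twoTorsion_localPoints_smul_ne_of_Δ_neg W w hΔ hσ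
    exact @localH1_eq_zero ℚ _ W _ w.Completion _ (_) _ _
      (natCard_absoluteGaloisGroup_completion_infinitePlace_le_two w) ⟨σ, T, hT2, hσT⟩ x
  · push Not at h
    obtain ⟨φ, rfl⟩ := oneCocycleClass_surjective _ x
    rw [oneCocycleClass_eq_zero_iff]
    exact ⟨0, fun g ↦ by rw [h g, contOneCocycles.apply_one, map_zero, sub_zero]⟩

/-- **`Δ(E) < 0` ⟹ `H¹(ℚ, E) → H¹(ℚ_∞, E)` is ZERO**: `localRestrictionKer W ℚ_∞ = ⊤` — the real place
imposes no condition (sharp; the tree had it up to `2`). [cite: GrossLMS1991, §6 (proof of Prop. 6.2 (1))] -/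
theorem localRestrictionKer_infinitePlace_eq_top_of_Δ_neg (hΔ : W.Δ < 0) :
    W.localRestrictionKer w.Completion = ⊤ := by
  rw [eq_top_iff]
  intro x _
  rw [localRestrictionKer_eq_ker, AddMonoidHom.mem_ker]
  exact localH1_infinitePlace_eq_zero_of_Δ_neg W w hΔ _

/-- **`Δ(E) < 0` ⟹ the `p^∞`-Selmer condition at `∞` is vacuous** for every `p`:
`selmerLocalKerPrimary W ℚ_∞ p = ⊤`. At `p = 2` this is the statement the eigen/`ℚ` architecture of
Q3 needs: `Sel_{2^∞}(E/ℚ)` and Poitou–Tate over `ℚ` see no archimedean term on the habitat.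
[cite: GrossLMS1991, §6 (proof of Prop. 6.2 (1))] [cite: MilneADT2006, I Rem. 3.7] -/
theorem selmerLocalKerPrimary_infinitePlace_eq_top_of_Δ_neg (hΔ : W.Δ < 0) (p : ℕ) :
    selmerLocalKerPrimary W w.Completion p = ⊤ := by
  rw [selmerLocalKerPrimary_eq_comap, localRestrictionKer_infinitePlace_eq_top_of_Δ_neg W w hΔ,
    AddSubgroup.comap_top]

/-- **… and the same for every quadratic twist `E^{(d)}`, `d ≠ 0`** (`Δ(E^{(d)}) = d⁶ Δ(E) < 0`): in
particular for the twin `E^K` of the genus line. [cite: SilvermanAEC2009, X.§2 (quadratic twists)] -/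
theorem selmerLocalKerPrimary_infinitePlace_quadraticTwist_eq_top_of_Δ_neg (hΔ : W.Δ < 0) {d : ℚ}
    (hd : d ≠ 0) (p : ℕ) :
    selmerLocalKerPrimary (W.quadraticTwist d) w.Completion p = ⊤ := by
  haveI : (W.quadraticTwist d).IsElliptic := W.isElliptic_quadraticTwist hd
  refine selmerLocalKerPrimary_infinitePlace_eq_top_of_Δ_neg (W.quadraticTwist d) w ?_ p
  rw [quadraticTwist_Δ]
  exact mul_neg_of_pos_of_neg (by positivity) hΔ

end Habitat

end Summit.BirchSwinnertonDyer.BirchSwinnertonDyer.Theorems.GenusExact.ArchVanishing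

end
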